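import Literature.Computability.AlgebraicComplexity.LR17FullExteriorDetReprProofs
import Literature.Computability.AlgebraicComplexity.LandsbergRessayreEquivariantUpper
import Literature.Computability.AlgebraicComplexity.LR17RegularDetLowerBounds
import HarnessLib

/-!
# LR17 Prop. 2.10 — the printed `𝔾_{perm_m}`-equivariant representation of `perm_m` of size
# `C(2m,m) - 1`; discharge of `lr_prop_2_10` (and Thm. 2.13 unconditionally)

Topic `Literature/Computability/AlgebraicComplexity`. Companion (proofs only; no definitions, no
named facts) of `LR17EquivariantRepresentations.lean`, where Landsberg–Ressayre's Prop. 2.10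
(arXiv:1508.05788, p0006:L66–L82; Differential Geom. Appl. 55 (2017) 146–166) is vended as the matrix
`LR17.permFullMatrix k m c` on `LR17.FullIdx m = {(S₁,S₂) : |S₁| = |S₂| < m}`
(`ℂⁿ = ⊕_{k<m} (SᵏE)_reg ⊗ (SᵏF*)_reg`, `n = C(2m,m) - 1`): `Ã = c Λ₀ + Σ_k S_k` — `c` on the
diagonal at levels `≥ 1` and the variable `x_{ij}` in row `(S₁ ∪ i, S₂ ∪ j)` (top level wrapped to
`(∅,∅)`), column `(S₁,S₂)` — with the printed scalar `c = LR17.lamScale m = (m!)^{-1/(n-m)}` in the named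
fact `lr_prop_2_10` ("Then `(-1)^{m+1} perm_m = det_n ∘ Ã`", EQUIVARIANT for
`𝔾_{perm_m} = permSymmetrySubst`). The tree already PROVES the content of Prop. 2.10 / Thm. 2.1 `≤`
for ITS OWN matrix (the signed `(snk,src)`-minor of the pairs program with one row divided by `m!`,
`LandsbergRessayreEquivariantUpper.lean`, `hasEquivariantDetRepr_perPoly_permSymmetrySubst`); what
this file adds is the PRINTED matrix with the PRINTED gauge, i.e. the discharge
`lr_prop_2_10_holds : lr_prop_2_10` (net debt `-1`), by the machinery of the Prop. 2.17 companion
`LR17FullExteriorDetReprProofs.lean` (same index type, same scalar-on-`Λ₀` shape, same `c`).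

## The printed proof (p0014:L3–L13, p0013:L41–L109) and how it is followed
"The maps `s_k(v)` … are related to the maps `ex_k(v)` … The maps are the same on these basis
vectors except for with `s_k(v)` all the coefficients are positive … Thus the polynomial computed by
(2) is the same as the polynomial computed by (5) except all the `yⁱⱼ` appear positively. … The maps
`S_k` and `EX_k` are similarly related and we conclude this case similarly."
* **Determinant** (`LR17.det_permFullMatrix`, any field, any `c ≠ 0`):
  `det Ã = (-1)^{m+1} c^{n-m} m! perm_m` — verbatim the computation of `LR17.det_detFullMatrix` with
  the Koszul signs deleted: row-scaled `Ãᵀ` is the block of `1 - A` for the balanced-pairs program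
  with arc weights `-c^{-[S₁≠∅]} x_{ij}` (`LR17.pairArc_adjugate_one_sub_src_snk`), the full path sum is
  `Σ_{σ,τ} ∏ₜ x_{σt,τt} = m! perm_m` (`LR17.sum_perm_perm_prod`), and `c^{n-m} m! = 1` for the printed
  `c` (`LR17.lamScale_pow_mul_factorial`).
* **Equivariance** (`LR17.isEquivariantDetRepr_permFullMatrix`, any field, any `c ≠ 0`, any
  indexing `e`), generator by generator (`IsEquivariantDetRepr.of_generators`):
  the permutations `P_π ⊗ 1` of `E` RELABEL `Ã` by `(S₁,S₂) ↦ (π⁻¹S₁, S₂)`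
  (`permFullMatrix_map_leftPerm`) and the transposition relabels by the swap `(S₁,S₂) ↦ (S₂,S₁)`
  (`permFullMatrix_map_transpose`; "there exist two permutation matrices `B₁, B₂` … `Ã(Mᵀ) =
  B₁ Ã(M) B₂⁻¹`", p0013:L105–L109, "transferred" at p0014:L13) — both lift to permutation matrices
  (`exists_lift_of_relabel`); the torus `diag d ⊗ 1` of `E` acts by the DIAGONAL gauge
  `q(S₁,S₂) = ∏_{s∈S₁} d_s` on columns and `p = q` except `p(∅,∅) = ∏ᵢ dᵢ` on rows (the wrapped top
  level `(SᵐE)_reg ≃ S⁰E` carries `det`; `permFullMatrix_map_leftDiag`, `exists_lift_leftDiag_perm`);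
  and the `F`-symmetries need no computation: `1 ⊗ h = τ (h ⊗ 1) τ`, so
  `permSymmetrySubst ≤ closure({P_π ⊗ 1} ∪ {diag d ⊗ 1} ∪ {τ})`
  (`LR17.permSymmetrySubst_le_closure_left_transpose`, from `LRPairs.leftMonomialSubst_le_closure`).
  DEVIATION: none in content; the paper's "reviewing the sign calculation" is replaced by the direct
  unsigned path expansion, as in the Prop. 2.17 companion.
* **Thm. 2.13 unconditionally**: `LR17.regularEquivariantDetComplexity_detPoly_eq_choose_sub_one`
  (`srdc(det_m) = C(2m,m) - 1`, `m ≥ 1`) = `lr_thm_2_13_eq_of_prop_2_17` (`LR17RegularDetLowerBounds.lean`,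
  from `lr_thm_2_13_ge_holds`) fed with `lr_prop_2_17_holds` (`LR17FullExteriorDetReprProofs.lean`).
Honest framing (cell `val-lit`): discharges of printed statements; nothing here bears on `VP ≠ VNP`
beyond what Landsberg–Ressayre print.

## Main statements
* `LR17.det_permFullMatrix`, `LR17.isAffineDetRepr_permFullMatrix`, `LR17.isEquivariantDetRepr_permFullMatrix`;
* `lr_prop_2_10_holds : lr_prop_2_10` — **the discharge** (over `ℂ`, printed scalar);
* `LR17.regularEquivariantDetComplexity_detPoly_eq_choose_sub_one` — **Thm. 2.13, unconditional**;
* reusable: `LR17.sum_perm_perm_prod`, `LR17.permSymmetrySubst_le_closure_left_transpose`.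

## References
* [LandsbergRessayre2017] J. M. Landsberg, N. Ressayre, *Permanent v. determinant: an exponential
  lower bound assuming symmetry and a potential path towards Valiant's conjecture*, Differential
  Geom. Appl. 55 (2017) 146–166, arXiv:1508.05788, Prop. 2.10 (p0006:L66–L82), §6 (p0014:L3–L13),
  §4.2 (p0013:L41–L109), §2.1 (`𝔾_{perm_m}`, p0005:L95–L121), Thm. 2.13 (p0006:L127–L129).
* [Grenet2012Thesis] B. Grenet, PhD thesis, ENS Lyon (2012), Lemme 3.17 (path sums; the tree's
  `GrenetWeightedPaths.lean`, `LandsbergRessayrePairsProgram.lean`).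
-/

noncomputable section

open Matrix MvPolynomial Finset
open scoped Kronecker

namespace Literature.Computability.AlgebraicComplexity

namespace LR17

/-! ### The determinant of Prop. 2.10's matrix -/

section PermDetAux

variable {R : Type*} [CommRing R] {m : ℕ}

/-- Double sums over injective maps are double sums over permutations. [folklore] -/
private theorem sum_sum_ite_injective' (F : (Fin m → Fin m) → (Fin m → Fin m) → R) :
    (∑ g : Fin m → Fin m, ∑ h : Fin m → Fin m,
        if Function.Injective g ∧ Function.Injective h then F g h else 0) =
      ∑ σ : Equiv.Perm (Fin m), ∑ τ : Equiv.Perm (Fin m), F σ τ := by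
  have step : ∀ g : Fin m → Fin m, (∑ h : Fin m → Fin m,
      if Function.Injective g ∧ Function.Injective h then F g h else 0) =
      if Function.Injective g then
        ∑ h : Fin m → Fin m, (if Function.Injective h then F g h else 0) else 0 := by
    intro g
    split_ifs with hg
    · refine sum_congr rfl fun h _ => ?_
      by_cases hh : Function.Injective h
      · rw [if_pos ⟨hg, hh⟩, if_pos hh]
      · rw [if_neg (fun H => hh H.2), if_neg hh]
    · exact sum_eq_zero fun h _ => if_neg fun H => hg H.1
  simp_rw [step]
  rw [Grenet.sum_ite_injective]
  exact sum_congr rfl fun σ _ => Grenet.sum_ite_injective _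

/-- `∏_{t < m} (if t = 0 then 1 else x) = x ^ (m - 1)` (`m ≥ 1`). [folklore] -/
private theorem prod_ite_val_eq_zero' (hm : 1 ≤ m) (x : R) :
    (∏ t : Fin m, if (t : ℕ) = 0 then (1 : R) else x) = x ^ (m - 1) := by
  obtain ⟨m', rfl⟩ : ∃ m', m = m' + 1 := ⟨m - 1, by omega⟩
  rw [Fin.prod_univ_succ, Fin.val_zero, if_pos rfl, one_mul, Nat.add_sub_cancel]
  simp only [Fin.val_succ, Nat.succ_ne_zero, if_false, prod_const, card_univ, Fintype.card_fin]

/-- The prefix set `σ({i < t})` is empty iff `t = 0`. [folklore] -/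
private theorem prefix_image_eq_empty_iff' (σ : Equiv.Perm (Fin m)) (t : Fin m) :
    (univ.filter fun i : Fin m => (i : ℕ) < (t : ℕ)).image σ = ∅ ↔ (t : ℕ) = 0 := by
  rw [← Finset.card_eq_zero, Grenet.card_prefix_image σ (le_of_lt t.2)]

/-- `m ≤ C(2m,m) - 1 = |FullIdx m|`. [folklore] -/
private theorem le_choose_sub_one' (m : ℕ) : m ≤ (2 * m).choose m - 1 := by
  rcases Nat.lt_or_ge m 2 with h | h
  · interval_cases m <;> decide
  · have h1 : (2 * m).choose 1 ≤ (2 * m).choose (2 * m / 2) := Nat.choose_le_middle 1 (2 * m)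
    rw [Nat.choose_one_right, Nat.mul_div_cancel_left m (by norm_num)] at h1
    omega

/-- **Double sum over permutations**: `∑_{σ, τ} ∏ₜ M (σ t) (τ t) = m! · ∑_ρ ∏ₛ M (ρ s) s` ("Grenet's
representation for `perm_m (y…y)` which is `m!(y¹₁⋯yᵐₘ)`", p0013:L75–L80, in the unsigned version
of p0014:L3–L13: each permutation arises from `m!` pairs of orderings).
[cite: LandsbergRessayre2017, Prop. 2.10] -/
theorem sum_perm_perm_prod (M : Fin m → Fin m → R) :
    ∑ σ : Equiv.Perm (Fin m), ∑ τ : Equiv.Perm (Fin m), ∏ t, M (σ t) (τ t) =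
      (m.factorial : R) * ∑ ρ : Equiv.Perm (Fin m), ∏ s, M (ρ s) s := by
  classical
  have key : ∀ τ : Equiv.Perm (Fin m),
      ∑ σ : Equiv.Perm (Fin m), ∏ t, M (σ t) (τ t) = ∑ ρ : Equiv.Perm (Fin m), ∏ s, M (ρ s) s := by
    intro τ
    have hprod : ∀ σ : Equiv.Perm (Fin m), ∏ t, M (σ t) (τ t) = ∏ s, M ((σ * τ⁻¹) s) s := by
      intro σ
      rw [← Equiv.prod_comp τ (fun s => M ((σ * τ⁻¹) s) s)]
      refine prod_congr rfl fun t _ => ?_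
      simp [Equiv.Perm.mul_apply]
    simp_rw [hprod]
    exact Fintype.sum_equiv (Equiv.mulRight τ⁻¹) _ _ fun σ => rfl
  rw [sum_comm]
  simp_rw [key]
  rw [sum_const, card_univ, Fintype.card_perm, Fintype.card_fin, nsmul_eq_mul]

end PermDetAux

section PermDet

variable (k : Type*) [Field k] (m : ℕ)

/-- The generic permanent as a permutation sum. [folklore] -/
private theorem perPoly_fin_eq_sum :
    perPoly (Fin m) k = ∑ σ : Equiv.Perm (Fin m), ∏ i, X (σ i, i) := by
  rw [perPoly, Matrix.permanent]
  rfl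

/-- **`det Ã = (-1)^{m+1} c^{n-m} m! · perm_m` for Prop. 2.10's matrix with scalar `c ≠ 0` on `Λ₀`**
(`n = C(2m,m) - 1`; p0006:L66–L82 with p0014:L3–L13: "the polynomial computed by (2) is the same as
the polynomial computed by (5) except all the `yⁱⱼ` appear positively"), over any field, `m ≥ 1`.
Proof exactly as for Prop. 2.17 (`LR17.det_detFullMatrix`) without the Koszul signs: after scaling the
rows of `Ãᵀ` at levels `≥ 1` by `c⁻¹`, `Ãᵀ` is the block, on the balanced proper pairs, of the unipotent
`1 - A` of the balanced-pairs program with arc weights `-c^{-[S₁≠∅]} x_{ij}` (row `snk` replaced by the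
unit row at `src`, columns `src`, `snk` swapped), so `c^{-(n-1)} det Ã = -adj(1 - A)_{src,snk}` is minus
the full path sum `(-1)^m c^{-(m-1)} Σ_{σ,τ} ∏ₜ x_{σt,τt} = (-1)^m c^{-(m-1)} m! perm_m`.
[cite: LandsbergRessayre2017, Prop. 2.10] -/
theorem det_permFullMatrix (hm : 1 ≤ m) {c : k} (hc : c ≠ 0) :
    (permFullMatrix k m c).det =
      C ((-1) ^ (m + 1) * c ^ ((2 * m).choose m - 1 - m) * (m.factorial : k)) * perPoly (Fin m) k := by
  classical
  -- the source and the sink of the balanced-pairs program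
  set src : {P : Finset (Fin m) × Finset (Fin m) // P.1.card = P.2.card} := ⟨(∅, ∅), rfl⟩ with hsrc
  set snk : {P : Finset (Fin m) × Finset (Fin m) // P.1.card = P.2.card} := ⟨(univ, univ), rfl⟩
    with hsnk
  have hne0 : (∅ : Finset (Fin m)) ≠ univ := by
    haveI : Nonempty (Fin m) := ⟨⟨0, hm⟩⟩
    exact Finset.univ_nonempty.ne_empty.symm
  have hne : src ≠ snk := fun h => hne0 (congrArg (fun P => P.1.1) h)
  have hbal0 : ∀ P : {P : Finset (Fin m) × Finset (Fin m) // P.1.card = P.2.card},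
      P.1.2 = ∅ ↔ P.1.1 = ∅ := fun P => by
    rw [← Finset.card_eq_zero, ← P.2, Finset.card_eq_zero]
  have hbalu : ∀ P : {P : Finset (Fin m) × Finset (Fin m) // P.1.card = P.2.card},
      P.1.2 = univ ↔ P.1.1 = univ := fun P => by
    rw [← Finset.card_eq_iff_eq_univ, ← P.2, Finset.card_eq_iff_eq_univ]
  have hsrc_iff : ∀ P : {P : Finset (Fin m) × Finset (Fin m) // P.1.card = P.2.card},
      P = src ↔ P.1.1 = ∅ := fun P => by
    constructor
    · rintro rfl; rfl
    · intro h
      exact Subtype.ext (Prod.ext h ((hbal0 P).2 h))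
  have hsnk_iff : ∀ P : {P : Finset (Fin m) × Finset (Fin m) // P.1.card = P.2.card},
      P = snk ↔ P.1.1 = univ := fun P => by
    constructor
    · rintro rfl; rfl
    · intro h
      exact Subtype.ext (Prod.ext h ((hbalu P).2 h))
  -- the scaled arc weights and the adjacency matrix of the balanced-pairs program
  set sc : Finset (Fin m) → MvPolynomial (Fin m × Fin m) k :=
    fun S => if S = ∅ then 1 else C c⁻¹ with hsc
  set w : Finset (Fin m) → Finset (Fin m) → Fin m → Fin m → MvPolynomial (Fin m × Fin m) k :=
    fun S T i j => -(sc S * X (i, j)) with hw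
  set A : Matrix {P : Finset (Fin m) × Finset (Fin m) // P.1.card = P.2.card}
      {P : Finset (Fin m) × Finset (Fin m) // P.1.card = P.2.card} (MvPolynomial (Fin m × Fin m) k) :=
    Matrix.of fun P Q => ∑ i, ∑ j,
      if i ∉ P.1.1 ∧ j ∉ P.1.2 ∧ Q.1 = (insert i P.1.1, insert j P.1.2)
      then w P.1.1 P.1.2 i j else 0 with hAdef
  have hA : ∀ P Q, A P Q = ∑ i, ∑ j,
      if i ∉ P.1.1 ∧ j ∉ P.1.2 ∧ Q.1 = (insert i P.1.1, insert j P.1.2)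
      then w P.1.1 P.1.2 i j else 0 := fun _ _ => rfl
  set D : Matrix {P : Finset (Fin m) × Finset (Fin m) // P.1.card = P.2.card}
      {P : Finset (Fin m) × Finset (Fin m) // P.1.card = P.2.card} (MvPolynomial (Fin m × Fin m) k) :=
    (1 - A).updateRow snk (Pi.single src 1) with hD
  set D' : Matrix {P : Finset (Fin m) × Finset (Fin m) // P.1.card = P.2.card}
      {P : Finset (Fin m) × Finset (Fin m) // P.1.card = P.2.card} (MvPolynomial (Fin m × Fin m) k) :=
    D.submatrix id (Equiv.swap src snk) with hD'
  -- the row scaling of `Ãᵀ` and the transport `FullIdx m ≃ {P // P.1.1 ≠ univ}`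
  set dF : FullIdx m → MvPolynomial (Fin m × Fin m) k := fun S => sc S.1.1 with hdF
  let ef : FullIdx m ≃ {P : {P : Finset (Fin m) × Finset (Fin m) // P.1.card = P.2.card} //
      P.1.1 ≠ univ} :=
    { toFun := fun p => ⟨⟨p.1, p.2.1⟩, p.2.2⟩
      invFun := fun q => ⟨q.1.1, q.1.2, q.2⟩
      left_inv := fun p => rfl
      right_inv := fun q => rfl }
  -- `diag(dF) Ãᵀ` is the `(≠ snk)`-block of `D'`
  have hblock : Matrix.reindex ef ef (Matrix.diagonal dF * (permFullMatrix k m c)ᵀ) =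
      D'.toSquareBlockProp fun P => P.1.1 ≠ univ := by
    refine Matrix.ext fun S' T' => ?_
    have hS'ne : S'.1 ≠ snk := fun h => S'.2 ((hsnk_iff _).1 h)
    have hT'ne : T'.1 ≠ snk := fun h => T'.2 ((hsnk_iff _).1 h)
    rw [Matrix.reindex_apply, Matrix.submatrix_apply, Matrix.diagonal_mul, Matrix.transpose_apply,
      Matrix.toSquareBlockProp_def, Matrix.of_apply, hD', Matrix.submatrix_apply, id, hD,
      Matrix.updateRow_ne hS'ne]
    change sc S'.1.1.1 * permFullMatrix k m c ⟨T'.1.1, T'.1.2, T'.2⟩ ⟨S'.1.1, S'.1.2, S'.2⟩ = _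
    rw [permFullMatrix, Matrix.of_apply]
    by_cases hT : T'.1 = src
    · -- the column of the source: the wrap arcs
      have hT1 : T'.1.1.1 = ∅ := (hsrc_iff _).1 hT
      have hT2 : T'.1.1.2 = ∅ := (hbal0 _).2 hT1
      have hsw : Equiv.swap src snk T'.1 = snk := by rw [hT, Equiv.swap_apply_left]
      rw [hsw, Matrix.sub_apply, Matrix.one_apply_ne hS'ne, zero_sub, hA,
        show snk.1 = (univ, univ) from rfl]
      have h1 : ¬((⟨T'.1.1, T'.1.2, T'.2⟩ : FullIdx m) = ⟨S'.1.1, S'.1.2, S'.2⟩ ∧ S'.1.1.1.Nonempty) := by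
        rintro ⟨h, hS⟩
        have h' : T'.1.1.1 = S'.1.1.1 := congrArg (fun p : FullIdx m => p.1.1) h
        rw [← h', hT1] at hS
        exact Finset.not_nonempty_empty hS
      rw [if_neg h1, zero_add, Finset.mul_sum, ← Finset.sum_neg_distrib]
      refine Finset.sum_congr rfl fun i _ => ?_
      rw [Finset.mul_sum, ← Finset.sum_neg_distrib]
      refine Finset.sum_congr rfl fun j _ => ?_
      have hw1 : ∀ Z : Finset (Fin m), Z ≠ ∅ → (∅ = wrap m Z ↔ univ = Z) := by
        intro Z hZ
        unfold wrap
        split_ifs with h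
        · exact ⟨fun _ => h.symm, fun _ => rfl⟩
        · exact ⟨fun h' => absurd h'.symm hZ, fun h' => absurd h'.symm h⟩
      have hwi := hw1 (insert i S'.1.1.1) (Finset.insert_ne_empty i _)
      have hwj := hw1 (insert j S'.1.1.2) (Finset.insert_ne_empty j _)
      simp only [hT1, hT2, hwi, hwj, Prod.mk.injEq]
      split_ifs with h
      · rw [hw, neg_neg]
      · rw [mul_zero, neg_zero]
    · -- a column at level `≥ 1`
      have hT1 : T'.1.1.1 ≠ ∅ := fun h => hT ((hsrc_iff _).2 h)
      have hT2 : T'.1.1.2 ≠ ∅ := fun h => hT1 ((hbal0 _).1 h)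
      have hT2u : T'.1.1.2 ≠ univ := fun h => T'.2 ((hbalu _).1 h)
      rw [Equiv.swap_apply_of_ne_of_ne hT hT'ne, Matrix.sub_apply, hA, Matrix.one_apply, mul_add,
        sub_eq_add_neg]
      congr 1
      · by_cases hST : S'.1 = T'.1
        · have hST' : S' = T' := Subtype.ext hST
          subst hST'
          have hS0 : S'.1.1.1.Nonempty := Finset.nonempty_iff_ne_empty.2 hT1
          rw [if_pos ⟨rfl, hS0⟩, if_pos rfl, hsc]
          dsimp only
          rw [if_neg hT1, ← map_mul, inv_mul_cancel₀ hc, map_one]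
        · rw [if_neg hST, if_neg, mul_zero]
          rintro ⟨h, -⟩
          exact hST (congrArg Subtype.val (ef.symm.injective h)).symm
      · rw [Finset.mul_sum, ← Finset.sum_neg_distrib]
        refine Finset.sum_congr rfl fun i _ => ?_
        rw [Finset.mul_sum, ← Finset.sum_neg_distrib]
        refine Finset.sum_congr rfl fun j _ => ?_
        have hw2 : ∀ (T Z : Finset (Fin m)), T ≠ ∅ → T ≠ univ → (T = wrap m Z ↔ T = Z) := by
          intro T Z hT0 hTu
          unfold wrap
          split_ifs with h
          · exact ⟨fun h' => absurd h' hT0, fun h' => absurd (h'.trans h) hTu⟩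
          · exact Iff.rfl
        simp only [hw2 _ _ hT1 T'.2, hw2 _ _ hT2 hT2u, Prod.ext_iff]
        split_ifs with h
        · rw [hw, neg_neg]
        · rw [mul_zero, neg_zero]
  -- `D'` is block lower triangular with corner entry `1`
  have htri : ∀ P, ¬(P.1.1 ≠ univ) → ∀ Q, Q.1.1 ≠ univ → D' P Q = 0 := by
    intro P hP Q hQ
    rw [not_ne_iff] at hP
    have hP' : P = snk := (hsnk_iff _).2 hP
    subst hP'
    have hsw : Equiv.swap src snk Q ≠ src := by
      intro h
      rw [Equiv.swap_apply_eq_iff, Equiv.swap_apply_left] at h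
      exact hQ ((hsnk_iff _).1 h)
    rw [hD', Matrix.submatrix_apply, id, hD, Matrix.updateRow_self]
    exact Pi.single_eq_of_ne hsw _
  have hcorner : (D'.toSquareBlockProp fun P => ¬(P.1.1 ≠ univ)).det = 1 := by
    have hcard : Fintype.card {P : {P : Finset (Fin m) × Finset (Fin m) // P.1.card = P.2.card} //
        ¬(P.1.1 ≠ univ)} = 1 := by
      rw [Fintype.card_subtype, Finset.card_eq_one]
      refine ⟨snk, Finset.ext fun P => ?_⟩
      rw [Finset.mem_filter, Finset.mem_singleton, not_ne_iff, ← hsnk_iff]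
      simp
    rw [Matrix.det_eq_elem_of_card_eq_one hcard ⟨snk, fun h => h rfl⟩,
      Matrix.toSquareBlockProp_def, Matrix.of_apply, hD', Matrix.submatrix_apply, id, hD,
      Matrix.updateRow_self, Equiv.swap_apply_right, Pi.single_eq_same]
  have hdetD' : D'.det = (Matrix.diagonal dF * (permFullMatrix k m c)ᵀ).det := by
    rw [Matrix.twoBlockTriangular_det D' (fun P => P.1.1 ≠ univ) htri, hcorner, mul_one, ← hblock,
      Matrix.det_reindex_self]
  -- hence `det (diag(dF) Ãᵀ) = -adj(1 - A)_{src,snk}` = minus the full path sum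
  have hdet : (Matrix.diagonal dF * (permFullMatrix k m c)ᵀ).det =
      -∑ σ : Equiv.Perm (Fin m), ∑ τ : Equiv.Perm (Fin m),
        ∏ t : Fin m, w ((univ.filter fun i : Fin m => (i : ℕ) < (t : ℕ)).image σ)
          ((univ.filter fun i : Fin m => (i : ℕ) < (t : ℕ)).image τ) (σ t) (τ t) := by
    rw [← hdetD', hD', Matrix.det_permute', Equiv.Perm.sign_swap hne, hD, ← Matrix.adjugate_apply,
      pairArc_adjugate_one_sub_src_snk w hA, sum_sum_ite_injective']
    simp
  -- the path products
  have hpath : ∀ σ τ : Equiv.Perm (Fin m),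
      (∏ t : Fin m, w ((univ.filter fun i : Fin m => (i : ℕ) < (t : ℕ)).image σ)
          ((univ.filter fun i : Fin m => (i : ℕ) < (t : ℕ)).image τ) (σ t) (τ t)) =
        C ((-1) ^ m * c⁻¹ ^ (m - 1)) * ∏ t : Fin m, X (σ t, τ t) := by
    intro σ τ
    have hwt : ∀ t : Fin m, w ((univ.filter fun i : Fin m => (i : ℕ) < (t : ℕ)).image σ)
          ((univ.filter fun i : Fin m => (i : ℕ) < (t : ℕ)).image τ) (σ t) (τ t) =
        (-1) * ((if (t : ℕ) = 0 then (1 : MvPolynomial (Fin m × Fin m) k) else C c⁻¹) *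
          X (σ t, τ t)) := by
      intro t
      have hsct : sc ((univ.filter fun i : Fin m => (i : ℕ) < (t : ℕ)).image σ) =
          if (t : ℕ) = 0 then 1 else C c⁻¹ := by
        rw [hsc]
        dsimp only
        by_cases ht : (t : ℕ) = 0
        · rw [if_pos ((prefix_image_eq_empty_iff' σ t).2 ht), if_pos ht]
        · rw [if_neg (fun h => ht ((prefix_image_eq_empty_iff' σ t).1 h)), if_neg ht]
      rw [hw]
      dsimp only
      rw [hsct, neg_one_mul]
    simp_rw [hwt]
    rw [Finset.prod_mul_distrib, Finset.prod_const, Finset.card_univ, Fintype.card_fin,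
      Finset.prod_mul_distrib, prod_ite_val_eq_zero' hm]
    simp only [map_mul, map_pow, map_neg, map_one]
    ring
  -- the full path sum is `(-1)^m c^{-(m-1)} m! perm_m`
  have hsum : (∑ σ : Equiv.Perm (Fin m), ∑ τ : Equiv.Perm (Fin m),
        ∏ t : Fin m, w ((univ.filter fun i : Fin m => (i : ℕ) < (t : ℕ)).image σ)
          ((univ.filter fun i : Fin m => (i : ℕ) < (t : ℕ)).image τ) (σ t) (τ t)) =
      C ((-1) ^ m * c⁻¹ ^ (m - 1) * (m.factorial : k)) * perPoly (Fin m) k := by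
    simp_rw [hpath]
    simp_rw [← Finset.mul_sum]
    rw [sum_perm_perm_prod (R := MvPolynomial (Fin m × Fin m) k) (fun i j => X (i, j)),
      perPoly_fin_eq_sum]
    simp only [map_mul, map_natCast, map_pow, map_neg, map_one]
    ring
  -- `det (diag(dF) Ãᵀ) = c^{-(n-1)} det Ã`
  have hprodF : (∏ S : FullIdx m, dF S) = C c⁻¹ ^ ((2 * m).choose m - 1 - 1) := by
    set srcF : FullIdx m := ⟨(∅, ∅), rfl, hne0⟩ with hsrcF
    rw [← card_fullIdx, ← Finset.prod_erase_mul _ _ (Finset.mem_univ srcF)]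
    have h1 : dF srcF = 1 := if_pos rfl
    rw [h1, mul_one, Finset.prod_congr rfl (fun S hS => ?_), Finset.prod_const,
      Finset.card_erase_of_mem (Finset.mem_univ _), Finset.card_univ]
    rw [Finset.mem_erase] at hS
    have hS0 : S.1.1 ≠ ∅ := by
      intro h
      refine hS.1 (Subtype.ext (Prod.ext h ?_))
      rw [← Finset.card_eq_zero, ← S.2.1, h, Finset.card_empty]
    exact if_neg hS0
  have hL : (Matrix.diagonal dF * (permFullMatrix k m c)ᵀ).det =
      C (c⁻¹ ^ ((2 * m).choose m - 1 - 1)) * (permFullMatrix k m c).det := by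
    rw [Matrix.det_mul, Matrix.det_diagonal, hprodF, Matrix.det_transpose, map_pow]
  -- conclusion
  have hnm : m ≤ (2 * m).choose m - 1 := le_choose_sub_one' m
  have he : (2 * m).choose m - 1 - 1 = ((2 * m).choose m - 1 - m) + (m - 1) := by omega
  have key : C (c⁻¹ ^ ((2 * m).choose m - 1 - 1)) * (permFullMatrix k m c).det =
      -(C ((-1) ^ m * c⁻¹ ^ (m - 1) * (m.factorial : k)) * perPoly (Fin m) k) := by
    rw [← hL, hdet, hsum]
  have hcc : C (c ^ ((2 * m).choose m - 1 - 1)) * C (c⁻¹ ^ ((2 * m).choose m - 1 - 1)) =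
      (1 : MvPolynomial (Fin m × Fin m) k) := by
    rw [← map_mul, ← mul_pow, mul_inv_cancel₀ hc, one_pow, map_one]
  have hcm : (C c : MvPolynomial (Fin m × Fin m) k) ^ (m - 1) * (C c⁻¹) ^ (m - 1) = 1 := by
    rw [← mul_pow, ← map_mul, mul_inv_cancel₀ hc, map_one, one_pow]
  calc (permFullMatrix k m c).det
      = C (c ^ ((2 * m).choose m - 1 - 1)) * (C (c⁻¹ ^ ((2 * m).choose m - 1 - 1)) *
          (permFullMatrix k m c).det) := by rw [← mul_assoc, hcc, one_mul]
    _ = C (c ^ ((2 * m).choose m - 1 - 1)) *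
          -(C ((-1) ^ m * c⁻¹ ^ (m - 1) * (m.factorial : k)) * perPoly (Fin m) k) := by rw [key]
    _ = _ := by
        rw [he, pow_succ]
        simp only [map_mul, map_pow, map_neg, map_one, map_natCast, pow_add]
        linear_combination (-((-1) ^ m * (C c : MvPolynomial (Fin m × Fin m) k) ^
          ((2 * m).choose m - 1 - m) * (m.factorial : MvPolynomial (Fin m × Fin m) k) *
            perPoly (Fin m) k)) * hcm

/-- The entries of Prop. 2.10's matrix are affine linear. [cite: LandsbergRessayre2017, Prop. 2.10] -/
theorem totalDegree_permFullMatrix_le (c : k) (T S : FullIdx m) :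
    (permFullMatrix k m c T S).totalDegree ≤ 1 := by
  rw [permFullMatrix, Matrix.of_apply]
  refine (totalDegree_add _ _).trans (max_le ?_ ?_)
  · split_ifs
    · exact (totalDegree_C _).le.trans zero_le_one
    · simp
  · refine totalDegree_finsetSum_le fun i _ => totalDegree_finsetSum_le fun j _ => ?_
    split_ifs
    · exact (totalDegree_X _).le
    · simp

variable {m} in
/-- **Prop. 2.10, as a plain representation:** `Ã` (any `c ≠ 0`, any indexing `e`) is an affine
determinantal representation of `(-1)^{m+1} c^{n-m} m! · perm_m`. [cite: LandsbergRessayre2017, Prop. 2.10] -/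
theorem isAffineDetRepr_permFullMatrix (hm : 1 ≤ m) {c : k} (hc : c ≠ 0) {n : ℕ}
    (e : FullIdx m ≃ Fin n) :
    IsAffineDetRepr
      (C ((-1) ^ (m + 1) * c ^ ((2 * m).choose m - 1 - m) * (m.factorial : k)) * perPoly (Fin m) k)
      (Matrix.reindex e e (permFullMatrix k m c)) := by
  refine ⟨fun i j => ?_, ?_⟩
  · rw [Matrix.reindex_apply, Matrix.submatrix_apply]
    exact totalDegree_permFullMatrix_le k m c _ _
  · rw [Matrix.det_reindex_self, det_permFullMatrix k m hm hc]

end PermDet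

/-! ### The substitutions `P_π ⊗ 1`, `diag d ⊗ 1` and `transp` on Prop. 2.10's matrix -/

section PermSubst

variable {k : Type*} [Field k] {m : ℕ}

/-- `P_π ⊗ 1` is the permutation matrix of `π × 1` on index pairs. [folklore] -/
private theorem permMatrix_kronecker_one' (π : Equiv.Perm (Fin m)) :
    π.permMatrix k ⊗ₖ (1 : Matrix (Fin m) (Fin m) k) =
      Equiv.Perm.permMatrix k (Equiv.prodCongr π (Equiv.refl (Fin m))) := by
  refine Matrix.ext fun p q => ?_
  obtain ⟨a, b⟩ := p
  obtain ⟨c, d⟩ := q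
  simp only [Matrix.kronecker_apply, PEquiv.toMatrix_apply, Equiv.toPEquiv_apply, Option.mem_def,
    Option.some.injEq, Matrix.one_apply, Equiv.prodCongr_apply, Prod.map_apply, Equiv.coe_refl,
    id_eq, Prod.mk.injEq]
  by_cases h1 : π a = c <;> by_cases h2 : b = d <;> simp [h1, h2]

/-- The left substitution `P_π ⊗ 1` renames the FIRST index: `x_{ij} ↦ x_{π⁻¹ i, j}`. [folklore] -/
private theorem linSubst_permKron_X' (π : Equiv.Perm (Fin m)) (i j : Fin m) :
    linSubst (Fin m × Fin m) k (π.permMatrix k ⊗ₖ (1 : Matrix (Fin m) (Fin m) k)) (X (i, j)) =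
      X (π.symm i, j) := by
  rw [permMatrix_kronecker_one', linSubst_permMatrix, rename_X]
  rfl

/-- The left substitution `diag d ⊗ 1` scales the FIRST index: `x_{ij} ↦ d_i x_{ij}`. [folklore] -/
private theorem linSubst_diagKron_X (d : Fin m → k) (i j : Fin m) :
    linSubst (Fin m × Fin m) k (Matrix.diagonal d ⊗ₖ (1 : Matrix (Fin m) (Fin m) k)) (X (i, j)) =
      C (d i) * X (i, j) := by
  classical
  rw [linSubst_X, Fintype.sum_prod_type]
  simp_rw [Matrix.kronecker_apply, Matrix.diagonal_apply, Matrix.one_apply, mul_ite, mul_one,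
    mul_zero, ite_smul, zero_smul, Finset.sum_ite_eq', Finset.mem_univ, if_true]
  rw [Finset.sum_ite_eq', if_pos (Finset.mem_univ _), MvPolynomial.smul_eq_C_mul]

/-- The transposition substitution swaps the indices: `x_{ij} ↦ x_{ji}`. [folklore] -/
private theorem linSubst_transpose_X' (i j : Fin m) :
    linSubst (Fin m × Fin m) k (Equiv.Perm.permMatrix k (Equiv.prodComm (Fin m) (Fin m))) (X (i, j)) =
      X (j, i) := by
  rw [linSubst_permMatrix, rename_X]
  rfl

variable (m) in
/-- The swap `(S₁, S₂) ↦ (S₂, S₁)` of `FullIdx m` is well defined. [cite: LandsbergRessayre2017, Prop. 2.10] -/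
private theorem swapIdx_wd' (p : FullIdx m) :
    (p.1.2, p.1.1).1.card = (p.1.2, p.1.1).2.card ∧ (p.1.2, p.1.1).1 ≠ univ := by
  refine ⟨p.2.1.symm, fun h => p.2.2 ?_⟩
  exact Finset.eq_univ_of_card _ (by rw [p.2.1, show p.1.2 = univ from h, Finset.card_univ])

variable (m) in
/-- The relabelling `(S₁, S₂) ↦ (π⁻¹ S₁, S₂)` of `FullIdx m` is well defined.
[cite: LandsbergRessayre2017, Prop. 2.10] -/
private theorem leftPermIdx_wd (π : Equiv.Perm (Fin m)) (p : FullIdx m) :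
    (p.1.1.image π.symm, p.1.2).1.card = (p.1.1.image π.symm, p.1.2).2.card ∧
      (p.1.1.image π.symm, p.1.2).1 ≠ univ := by
  refine ⟨by rw [Finset.card_image_of_injective _ π.symm.injective]; exact p.2.1, fun h => p.2.2 ?_⟩
  have hc := congrArg Finset.card (show p.1.1.image π.symm = univ from h)
  rw [Finset.card_image_of_injective _ π.symm.injective, Finset.card_univ] at hc
  exact Finset.eq_univ_of_card _ hc

/-- **`Ã(xᵀ)` is `Ã(x)` relabelled by the swap** `(S₁,S₂) ↦ (S₂,S₁)` (p0013:L101–L109, transferred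
to the permanent at p0014:L13). [cite: LandsbergRessayre2017, Prop. 2.10] -/
private theorem permFullMatrix_map_transpose (c : k) (T S : FullIdx m) :
    linSubst (Fin m × Fin m) k (Equiv.Perm.permMatrix k (Equiv.prodComm (Fin m) (Fin m)))
        (permFullMatrix k m c T S) =
      permFullMatrix k m c ⟨(T.1.2, T.1.1), swapIdx_wd' m T⟩ ⟨(S.1.2, S.1.1), swapIdx_wd' m S⟩ := by
  rw [permFullMatrix, Matrix.of_apply, Matrix.of_apply, map_add, map_sum]
  congr 1
  · have hiff : (T = S ∧ S.1.1.Nonempty) ↔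
        ((⟨(T.1.2, T.1.1), swapIdx_wd' m T⟩ : FullIdx m) = ⟨(S.1.2, S.1.1), swapIdx_wd' m S⟩ ∧
          S.1.2.Nonempty) := by
      rw [Subtype.ext_iff, Subtype.ext_iff, Prod.ext_iff, Prod.ext_iff, ← Finset.card_pos,
        ← Finset.card_pos, S.2.1]
      simp only
      tauto
    split_ifs with h1 h2 h2
    · exact linSubst_C _ _ _ _
    · exact absurd (hiff.1 h1) h2
    · exact absurd (hiff.2 h2) h1
    · exact map_zero _
  · rw [Finset.sum_comm]
    refine Finset.sum_congr rfl fun j _ => ?_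
    rw [map_sum]
    refine Finset.sum_congr rfl fun i _ => ?_
    have hiff : (j ∉ S.1.1 ∧ i ∉ S.1.2 ∧ T.1.1 = wrap m (insert j S.1.1) ∧
        T.1.2 = wrap m (insert i S.1.2)) ↔
        (i ∉ S.1.2 ∧ j ∉ S.1.1 ∧ T.1.2 = wrap m (insert i S.1.2) ∧
          T.1.1 = wrap m (insert j S.1.1)) := by tauto
    simp only
    by_cases h : j ∉ S.1.1 ∧ i ∉ S.1.2 ∧ T.1.1 = wrap m (insert j S.1.1) ∧
        T.1.2 = wrap m (insert i S.1.2)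
    · rw [if_pos h, if_pos (hiff.1 h), linSubst_transpose_X']
    · rw [if_neg h, if_neg (fun h' => h (hiff.2 h')), map_zero]

/-- `wrap` commutes with relabelling by a permutation of `[m]`. [folklore] -/
private theorem wrap_image (π : Equiv.Perm (Fin m)) (Z : Finset (Fin m)) :
    wrap m (Z.image π) = (wrap m Z).image π := by
  have huniv : Z.image π = univ ↔ Z = univ := by
    constructor
    · intro h
      apply Finset.eq_univ_of_card
      rw [← Finset.card_image_of_injective Z π.injective, h, Finset.card_univ]
    · rintro rfl
      exact Finset.image_univ_equiv π
  unfold wrap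
  by_cases h : Z = univ
  · rw [if_pos h, if_pos (huniv.2 h), Finset.image_empty]
  · rw [if_neg h, if_neg (fun h' => h (huniv.1 h'))]

/-- **`Ã((P_π ⊗ 1) · x)` is `Ã(x)` relabelled by `(S₁,S₂) ↦ (π⁻¹S₁, S₂)`** (the permutations of `E`
act on the monomial basis of `⊕_k (SᵏE)_reg ⊗ (SᵏF*)_reg` by relabelling, p0014:L3–L13 with §2.2).
[cite: LandsbergRessayre2017, Prop. 2.10] -/
private theorem permFullMatrix_map_leftPerm (π : Equiv.Perm (Fin m)) (c : k) (T S : FullIdx m) :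
    linSubst (Fin m × Fin m) k (π.permMatrix k ⊗ₖ (1 : Matrix (Fin m) (Fin m) k))
        (permFullMatrix k m c T S) =
      permFullMatrix k m c ⟨(T.1.1.image π.symm, T.1.2), leftPermIdx_wd m π T⟩
        ⟨(S.1.1.image π.symm, S.1.2), leftPermIdx_wd m π S⟩ := by
  rw [permFullMatrix, Matrix.of_apply, Matrix.of_apply, map_add, map_sum]
  congr 1
  · have hiff : (T = S ∧ S.1.1.Nonempty) ↔
        ((⟨(T.1.1.image π.symm, T.1.2), leftPermIdx_wd m π T⟩ : FullIdx m) =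
            ⟨(S.1.1.image π.symm, S.1.2), leftPermIdx_wd m π S⟩ ∧ (S.1.1.image π.symm).Nonempty) := by
      rw [Subtype.ext_iff, Subtype.ext_iff, Prod.ext_iff, Prod.ext_iff, Finset.image_nonempty,
        Finset.image_inj π.symm.injective]
    split_ifs with h1 h2 h2
    · exact linSubst_C _ _ _ _
    · exact absurd (hiff.1 h1) h2
    · exact absurd (hiff.2 h2) h1
    · exact map_zero _
  · -- reindex the sum over the inserted `E`-index by `π⁻¹`
    conv_rhs => rw [← Equiv.sum_comp π.symm]
    refine Finset.sum_congr rfl fun i _ => ?_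
    rw [map_sum]
    refine Finset.sum_congr rfl fun j _ => ?_
    simp only
    have hmem : π.symm i ∉ S.1.1.image π.symm ↔ i ∉ S.1.1 := by
      rw [Function.Injective.mem_finset_image π.symm.injective]
    have hins : insert (π.symm i) (S.1.1.image π.symm) = (insert i S.1.1).image π.symm := by
      rw [Finset.image_insert]
    have hwrap : (T.1.1.image π.symm = wrap m (insert (π.symm i) (S.1.1.image π.symm))) ↔
        T.1.1 = wrap m (insert i S.1.1) := by
      rw [hins, wrap_image, Finset.image_inj π.symm.injective]
    show (linSubst (Fin m × Fin m) k (π.permMatrix k ⊗ₖ (1 : Matrix (Fin m) (Fin m) k)))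
        (if i ∉ S.1.1 ∧ j ∉ S.1.2 ∧ T.1.1 = wrap m (insert i S.1.1) ∧ T.1.2 = wrap m (insert j S.1.2)
          then X (i, j) else 0) =
      if π.symm i ∉ S.1.1.image π.symm ∧ j ∉ S.1.2 ∧
          T.1.1.image π.symm = wrap m (insert (π.symm i) (S.1.1.image π.symm)) ∧
            T.1.2 = wrap m (insert j S.1.2)
        then X (π.symm i, j) else 0
    by_cases h : i ∉ S.1.1 ∧ j ∉ S.1.2 ∧ T.1.1 = wrap m (insert i S.1.1) ∧
        T.1.2 = wrap m (insert j S.1.2)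
    · rw [if_pos h, if_pos ⟨hmem.2 h.1, h.2.1, hwrap.2 h.2.2.1, h.2.2.2⟩, linSubst_permKron_X']
    · rw [if_neg h, if_neg, map_zero]
      rintro ⟨h1, h2, h3, h4⟩
      exact h ⟨hmem.1 h1, h2, hwrap.1 h3, h4⟩

/-- **`Ã((diag d ⊗ 1) · x)` is a diagonal gauge of `Ã(x)`**: with `q(S₁,S₂) = ∏_{s ∈ S₁} d_s` and
`p = q` except `p(∅,∅) = ∏ᵢ dᵢ` (the torus of `E` acts on the monomial basis diagonally, the wrapped
top level `(SᵐE)_reg ≃ S⁰E` carrying `det`), `q(S) · Ã(γ·x)_{T,S} = p(T) · Ã(x)_{T,S}`.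
[cite: LandsbergRessayre2017, Prop. 2.10] -/
private theorem permFullMatrix_map_leftDiag (d : Fin m → k) (c : k) (T S : FullIdx m) :
    C (∏ s ∈ S.1.1, d s) *
        linSubst (Fin m × Fin m) k (Matrix.diagonal d ⊗ₖ (1 : Matrix (Fin m) (Fin m) k))
          (permFullMatrix k m c T S) =
      C (if T.1.1 = ∅ then ∏ i, d i else ∏ t ∈ T.1.1, d t) * permFullMatrix k m c T S := by
  classical
  rw [permFullMatrix, Matrix.of_apply, map_add, map_sum, mul_add, mul_add]
  congr 1
  · by_cases h : T = S ∧ S.1.1.Nonempty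
    · obtain ⟨rfl, hS⟩ := h
      rw [if_pos ⟨rfl, hS⟩, linSubst_C, if_neg hS.ne_empty]
    · rw [if_neg h, map_zero, mul_zero, mul_zero]
  · rw [Finset.mul_sum, Finset.mul_sum]
    refine Finset.sum_congr rfl fun i _ => ?_
    rw [map_sum, Finset.mul_sum, Finset.mul_sum]
    refine Finset.sum_congr rfl fun j _ => ?_
    by_cases h : i ∉ S.1.1 ∧ j ∉ S.1.2 ∧ T.1.1 = wrap m (insert i S.1.1) ∧
        T.1.2 = wrap m (insert j S.1.2)
    · rw [if_pos h, linSubst_diagKron_X, ← mul_assoc, ← map_mul]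
      congr 2
      -- `p(T) = d_i · q(S)` along the arc `S → T`
      have hT : T.1.1 = wrap m (insert i S.1.1) := h.2.2.1
      unfold wrap at hT
      split_ifs at hT with hu
      · rw [if_pos hT, mul_comm, ← Finset.prod_insert h.1, hu]
      · rw [hT, if_neg (Finset.insert_ne_empty i _), Finset.prod_insert h.1, mul_comm]
    · rw [if_neg h, map_zero, mul_zero, mul_zero]

end PermSubst

/-! ### The exact lifts -/

section PermLifts

variable {k : Type*} [Field k] {m : ℕ}

/-- A row/column permutation of a square matrix is the two-sided product with permutation matrices:
`M.submatrix α α = P_α · M · P_{α⁻¹}`. [folklore] -/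
private theorem submatrix_eq_permMatrix_mul_mul' {R : Type*} [Semiring R] {N : ℕ}
    (M : Matrix (Fin N) (Fin N) R) (α : Equiv.Perm (Fin N)) :
    M.submatrix α α = α.permMatrix R * M * α⁻¹.permMatrix R := by
  rw [Equiv.Perm.permMatrix, Equiv.Perm.permMatrix, PEquiv.toMatrix_toPEquiv_mul,
    PEquiv.mul_toMatrix_toPEquiv, Matrix.submatrix_submatrix]
  rfl

/-- **Relabellings lift to permutation matrices.** If the substitution `γ` acts on a matrix `A` on
`FullIdx m` by a relabelling `ρ` of the indices, then `A` transported along any `e` has the exact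
lifts `(P_α, P_α)`, `α = e ∘ ρ ∘ e⁻¹`. [folklore] -/
private theorem exists_lift_of_relabel {n : ℕ} (e : FullIdx m ≃ Fin n)
    (A : Matrix (FullIdx m) (FullIdx m) (MvPolynomial (Fin m × Fin m) k))
    (γ : GL (Fin m × Fin m) k) (ρ : Equiv.Perm (FullIdx m))
    (hA : ∀ T S, linSubst (Fin m × Fin m) k (γ : Matrix (Fin m × Fin m) (Fin m × Fin m) k) (A T S) =
      A (ρ T) (ρ S)) :
    ∃ P Q : GL (Fin n) k,
      Matrix.linSubstEntries γ (Matrix.reindex e e A) =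
        (P : Matrix (Fin n) (Fin n) k).map C * Matrix.reindex e e A *
          ((Q⁻¹ : GL (Fin n) k) : Matrix (Fin n) (Fin n) k).map C := by
  classical
  let α : Equiv.Perm (Fin n) := (e.symm.trans ρ).trans e
  have hαi : ∀ i, α i = e (ρ (e.symm i)) := fun i => rfl
  have hsub : Matrix.linSubstEntries γ (Matrix.reindex e e A) = (Matrix.reindex e e A).submatrix α α := by
    refine Matrix.ext fun i j => ?_
    rw [Matrix.linSubstEntries, Matrix.map_apply, Matrix.reindex_apply, Matrix.submatrix_apply,
      Matrix.submatrix_apply, Matrix.submatrix_apply, hA, hαi i, hαi j, e.symm_apply_apply,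
      e.symm_apply_apply]
  let Pu : GL (Fin n) k :=
    ⟨α.permMatrix k, α⁻¹.permMatrix k,
      by rw [← Matrix.permMatrix_mul, inv_mul_cancel, Matrix.permMatrix_one],
      by rw [← Matrix.permMatrix_mul, mul_inv_cancel, Matrix.permMatrix_one]⟩
  refine ⟨Pu, Pu, ?_⟩
  have hPmap : ∀ σ : Equiv.Perm (Fin n), (σ.permMatrix k).map (C : k →+* MvPolynomial (Fin m × Fin m) k) =
      σ.permMatrix (MvPolynomial (Fin m × Fin m) k) := by
    intro σ
    refine Matrix.ext fun i j => ?_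
    simp only [Matrix.map_apply, PEquiv.toMatrix_apply]
    split_ifs
    · exact map_one _
    · exact map_zero _
  rw [hsub, show ((Pu⁻¹ : GL (Fin n) k) : Matrix (Fin n) (Fin n) k) = α⁻¹.permMatrix k from rfl,
    show ((Pu : GL (Fin n) k) : Matrix (Fin n) (Fin n) k) = α.permMatrix k from rfl, hPmap, hPmap]
  exact submatrix_eq_permMatrix_mul_mul' _ α

/-- **Lift of the transposition** for Prop. 2.10's matrix (any `c`, any indexing).
[cite: LandsbergRessayre2017, Prop. 2.10] -/
private theorem exists_lift_transpose_perm (c : k) {n : ℕ} (e : FullIdx m ≃ Fin n)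
    (γ : GL (Fin m × Fin m) k)
    (hγ : (γ : Matrix (Fin m × Fin m) (Fin m × Fin m) k) =
      Equiv.Perm.permMatrix k (Equiv.prodComm (Fin m) (Fin m))) :
    ∃ P Q : GL (Fin n) k,
      Matrix.linSubstEntries γ (Matrix.reindex e e (permFullMatrix k m c)) =
        (P : Matrix (Fin n) (Fin n) k).map C * Matrix.reindex e e (permFullMatrix k m c) *
          ((Q⁻¹ : GL (Fin n) k) : Matrix (Fin n) (Fin n) k).map C := by
  let ρ : Equiv.Perm (FullIdx m) :=
    { toFun := fun p => ⟨(p.1.2, p.1.1), swapIdx_wd' m p⟩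
      invFun := fun p => ⟨(p.1.2, p.1.1), swapIdx_wd' m p⟩
      left_inv := fun p => rfl
      right_inv := fun p => rfl }
  refine exists_lift_of_relabel e _ γ ρ fun T S => ?_
  rw [hγ]
  exact permFullMatrix_map_transpose c T S

/-- **Lift of a left permutation** `P_π ⊗ 1` for Prop. 2.10's matrix.
[cite: LandsbergRessayre2017, Prop. 2.10] -/
private theorem exists_lift_leftPerm_perm (c : k) {n : ℕ} (e : FullIdx m ≃ Fin n)
    (γ : GL (Fin m × Fin m) k) (π : Equiv.Perm (Fin m))
    (hγ : (γ : Matrix (Fin m × Fin m) (Fin m × Fin m) k) =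
      π.permMatrix k ⊗ₖ (1 : Matrix (Fin m) (Fin m) k)) :
    ∃ P Q : GL (Fin n) k,
      Matrix.linSubstEntries γ (Matrix.reindex e e (permFullMatrix k m c)) =
        (P : Matrix (Fin n) (Fin n) k).map C * Matrix.reindex e e (permFullMatrix k m c) *
          ((Q⁻¹ : GL (Fin n) k) : Matrix (Fin n) (Fin n) k).map C := by
  classical
  have hinv : ∀ p : FullIdx m,
      (⟨((p.1.1.image π.symm).image π.symm.symm, p.1.2), leftPermIdx_wd m π.symm
        ⟨(p.1.1.image π.symm, p.1.2), leftPermIdx_wd m π p⟩⟩ : FullIdx m) = p := by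
    intro p
    refine Subtype.ext (Prod.ext ?_ rfl)
    show (p.1.1.image π.symm).image π.symm.symm = p.1.1
    rw [Finset.image_image, show (π.symm.symm : Fin m → Fin m) ∘ π.symm = id from
      funext fun x => π.symm.symm_apply_apply x, Finset.image_id]
  have hinv' : ∀ p : FullIdx m,
      (⟨((p.1.1.image π.symm.symm).image π.symm, p.1.2), leftPermIdx_wd m π
        ⟨(p.1.1.image π.symm.symm, p.1.2), leftPermIdx_wd m π.symm p⟩⟩ : FullIdx m) = p := by
    intro p
    refine Subtype.ext (Prod.ext ?_ rfl)
    show (p.1.1.image π.symm.symm).image π.symm = p.1.1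
    rw [Finset.image_image, show (π.symm : Fin m → Fin m) ∘ π.symm.symm = id from
      funext fun x => π.symm.apply_symm_apply x, Finset.image_id]
  let ρ : Equiv.Perm (FullIdx m) :=
    { toFun := fun p => ⟨(p.1.1.image π.symm, p.1.2), leftPermIdx_wd m π p⟩
      invFun := fun p => ⟨(p.1.1.image π.symm.symm, p.1.2), leftPermIdx_wd m π.symm p⟩
      left_inv := fun p => hinv p
      right_inv := fun p => hinv' p }
  refine exists_lift_of_relabel e _ γ ρ fun T S => ?_
  rw [hγ]
  exact permFullMatrix_map_leftPerm π c T S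

/-- **Lift of a left torus element** `diag d ⊗ 1` (`d i ≠ 0`) for Prop. 2.10's matrix: the diagonal
gauge `P = diag(p)`, `Q = diag(q)` of `permFullMatrix_map_leftDiag`, transported along `e`.
[cite: LandsbergRessayre2017, Prop. 2.10] -/
private theorem exists_lift_leftDiag_perm (c : k) {n : ℕ} (e : FullIdx m ≃ Fin n)
    (γ : GL (Fin m × Fin m) k) (d : Fin m → k)
    (hγ : (γ : Matrix (Fin m × Fin m) (Fin m × Fin m) k) =
      Matrix.diagonal d ⊗ₖ (1 : Matrix (Fin m) (Fin m) k)) :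
    ∃ P Q : GL (Fin n) k,
      Matrix.linSubstEntries γ (Matrix.reindex e e (permFullMatrix k m c)) =
        (P : Matrix (Fin n) (Fin n) k).map C * Matrix.reindex e e (permFullMatrix k m c) *
          ((Q⁻¹ : GL (Fin n) k) : Matrix (Fin n) (Fin n) k).map C := by
  classical
  -- all `d i` are non-zero since `γ` is invertible
  have hd : ∀ i, d i ≠ 0 := by
    intro i hi
    have hdet : (γ : Matrix (Fin m × Fin m) (Fin m × Fin m) k).det ≠ 0 :=
      (Matrix.isUnits_det_units γ).ne_zero
    rw [hγ, Matrix.det_kronecker, Matrix.det_diagonal, Fintype.card_fin,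
      Finset.prod_eq_zero (Finset.mem_univ i) hi, zero_pow (ne_of_gt i.pos), zero_mul] at hdet
    exact hdet rfl
  -- the gauge functions
  set q : FullIdx m → k := fun S => ∏ s ∈ S.1.1, d s with hq
  set p : FullIdx m → k := fun T => if T.1.1 = ∅ then ∏ i, d i else ∏ t ∈ T.1.1, d t with hp
  have hq0 : ∀ S, q S ≠ 0 := fun S => Finset.prod_ne_zero_iff.2 fun s _ => hd s
  have hp0 : ∀ T, p T ≠ 0 := fun T => by
    rw [hp]
    dsimp only
    split_ifs
    · exact Finset.prod_ne_zero_iff.2 fun s _ => hd s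
    · exact Finset.prod_ne_zero_iff.2 fun s _ => hd s
  -- diagonal units on `Fin n`
  have hunit : ∀ (f : FullIdx m → k) (hf : ∀ S, f S ≠ 0),
      Matrix.reindex e e (Matrix.diagonal f) * Matrix.reindex e e (Matrix.diagonal fun S => (f S)⁻¹) = 1 ∧
      Matrix.reindex e e (Matrix.diagonal fun S => (f S)⁻¹) * Matrix.reindex e e (Matrix.diagonal f) = 1 := by
    intro f hf
    have hrr : ∀ A B : Matrix (FullIdx m) (FullIdx m) k,
        Matrix.reindex e e A * Matrix.reindex e e B = Matrix.reindex e e (A * B) := fun A B =>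
      Matrix.submatrix_mul_equiv A B e.symm e.symm e.symm
    have hr1 : Matrix.reindex e e (1 : Matrix (FullIdx m) (FullIdx m) k) = 1 :=
      Matrix.submatrix_one_equiv _
    constructor
    · rw [hrr, Matrix.diagonal_mul_diagonal, ← hr1, ← Matrix.diagonal_one]
      congr 2
      funext S
      exact mul_inv_cancel₀ (hf S)
    · rw [hrr, Matrix.diagonal_mul_diagonal, ← hr1, ← Matrix.diagonal_one]
      congr 2
      funext S
      exact inv_mul_cancel₀ (hf S)
  let Pu : GL (Fin n) k := ⟨_, _, (hunit p hp0).1, (hunit p hp0).2⟩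
  let Qu : GL (Fin n) k := ⟨_, _, (hunit q hq0).1, (hunit q hq0).2⟩
  refine ⟨Pu, Qu, ?_⟩
  -- the entrywise identity `Ã(γ·x)_{TS} = p(T) Ã(x)_{TS} q(S)⁻¹`
  have hPmap : ∀ f : FullIdx m → k, (Matrix.reindex e e (Matrix.diagonal f)).map
      (C : k →+* MvPolynomial (Fin m × Fin m) k) =
        Matrix.reindex e e (Matrix.diagonal fun S => C (f S)) := by
    intro f
    rw [Matrix.reindex_apply, Matrix.reindex_apply, ← Matrix.submatrix_map, Matrix.diagonal_map (map_zero C)]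
  have hrrR : ∀ A B : Matrix (FullIdx m) (FullIdx m) (MvPolynomial (Fin m × Fin m) k),
      Matrix.reindex e e A * Matrix.reindex e e B = Matrix.reindex e e (A * B) := fun A B =>
    Matrix.submatrix_mul_equiv A B e.symm e.symm e.symm
  rw [show ((Pu : GL (Fin n) k) : Matrix (Fin n) (Fin n) k) = Matrix.reindex e e (Matrix.diagonal p)
      from rfl,
    show ((Qu⁻¹ : GL (Fin n) k) : Matrix (Fin n) (Fin n) k) =
      Matrix.reindex e e (Matrix.diagonal fun S => (q S)⁻¹) from rfl, hPmap, hPmap, hrrR, hrrR]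
  refine Matrix.ext fun a b => ?_
  simp only [Matrix.reindex_apply, Matrix.submatrix_apply, Matrix.linSubstEntries, Matrix.map_apply]
  rw [Matrix.mul_diagonal, Matrix.diagonal_mul, hγ]
  have key := permFullMatrix_map_leftDiag d c (e.symm a) (e.symm b)
  have hqq : C ((q (e.symm b))⁻¹) * C (q (e.symm b)) = (1 : MvPolynomial (Fin m × Fin m) k) := by
    rw [← map_mul, inv_mul_cancel₀ (hq0 _), map_one]
  calc linSubst (Fin m × Fin m) k (Matrix.diagonal d ⊗ₖ (1 : Matrix (Fin m) (Fin m) k))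
        (permFullMatrix k m c (e.symm a) (e.symm b))
      = C ((q (e.symm b))⁻¹) * (C (q (e.symm b)) * linSubst (Fin m × Fin m) k
          (Matrix.diagonal d ⊗ₖ (1 : Matrix (Fin m) (Fin m) k))
          (permFullMatrix k m c (e.symm a) (e.symm b))) := by
        rw [← mul_assoc, hqq, one_mul]
    _ = C ((q (e.symm b))⁻¹) * (C (p (e.symm a)) * permFullMatrix k m c (e.symm a) (e.symm b)) := by
        rw [key]
    _ = _ := by ring

end PermLifts

/-! ### The realised symmetry group of `perm_m`: generators -/

section PermGroup

variable (k : Type*) [Field k] (m : ℕ)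

/-- `P_τ (A ⊗ B) P_τ = B ⊗ A` for the transposition permutation `τ = prodComm`. [folklore] -/
private theorem permMatrix_prodComm_mul_kronecker_mul' (A B : Matrix (Fin m) (Fin m) k) :
    Equiv.Perm.permMatrix k (Equiv.prodComm (Fin m) (Fin m)) * (A ⊗ₖ B) *
        Equiv.Perm.permMatrix k (Equiv.prodComm (Fin m) (Fin m)) = B ⊗ₖ A := by
  rw [Equiv.Perm.permMatrix, PEquiv.toMatrix_toPEquiv_mul, PEquiv.mul_toMatrix_toPEquiv]
  ext ⟨a, b⟩ ⟨c', d⟩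
  simp only [Matrix.submatrix_apply, id, Matrix.kronecker_apply]
  rw [show (Equiv.prodComm (Fin m) (Fin m)) (a, b) = (b, a) from rfl,
    show (Equiv.prodComm (Fin m) (Fin m)).symm (c', d) = (d, c') from rfl, Matrix.kronecker_apply,
    mul_comm]

/-- `P_τ² = 1` for the transposition permutation. [folklore] -/
private theorem permMatrix_prodComm_mul_self' :
    Equiv.Perm.permMatrix k (Equiv.prodComm (Fin m) (Fin m)) *
        Equiv.Perm.permMatrix k (Equiv.prodComm (Fin m) (Fin m)) = 1 := by
  rw [← Matrix.permMatrix_mul, show (Equiv.prodComm (Fin m) (Fin m) : Equiv.Perm (Fin m × Fin m)) *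
      Equiv.prodComm (Fin m) (Fin m) = 1 from Equiv.ext fun p => rfl, Matrix.permMatrix_one]

/-- **`𝔾_{perm_m}` is generated by `P_π ⊗ 1`, `diag d ⊗ 1` and the transposition**: the realised
symmetry group `permSymmetrySubst k m = [(T ⋊ 𝔖_m) × (T ⋊ 𝔖_m)] ⋊ ℤ₂` (p0005:L118–L121, §2.1)
lies in the subgroup generated by the LEFT monomial generators and `transp`, because
`1 ⊗ h = τ (h ⊗ 1) τ` (with `LRPairs.leftMonomialSubst_le_closure` of `LandsbergRessayreEquivariantUpper.lean`).
[cite: LandsbergRessayre2017, §2.1] -/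
theorem permSymmetrySubst_le_closure_left_transpose :
    permSymmetrySubst k m ≤ Subgroup.closure
      (({γ : GL (Fin m × Fin m) k | ∃ π : Equiv.Perm (Fin m),
          (γ : Matrix (Fin m × Fin m) (Fin m × Fin m) k) = π.permMatrix k ⊗ₖ (1 : Matrix (Fin m) (Fin m) k)} ∪
        {γ | ∃ d : Fin m → k,
          (γ : Matrix (Fin m × Fin m) (Fin m × Fin m) k) =
            Matrix.diagonal d ⊗ₖ (1 : Matrix (Fin m) (Fin m) k)}) ∪
        transposeSubstSet k m) := by
  classical
  set H : Subgroup (GL (Fin m × Fin m) k) := Subgroup.closure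
      (({γ : GL (Fin m × Fin m) k | ∃ π : Equiv.Perm (Fin m),
          (γ : Matrix (Fin m × Fin m) (Fin m × Fin m) k) = π.permMatrix k ⊗ₖ (1 : Matrix (Fin m) (Fin m) k)} ∪
        {γ | ∃ d : Fin m → k,
          (γ : Matrix (Fin m × Fin m) (Fin m × Fin m) k) =
            Matrix.diagonal d ⊗ₖ (1 : Matrix (Fin m) (Fin m) k)}) ∪
        transposeSubstSet k m) with hH
  let τu : GL (Fin m × Fin m) k :=
    ⟨Equiv.Perm.permMatrix k (Equiv.prodComm (Fin m) (Fin m)),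
      Equiv.Perm.permMatrix k (Equiv.prodComm (Fin m) (Fin m)),
      permMatrix_prodComm_mul_self' k m, permMatrix_prodComm_mul_self' k m⟩
  have hτ : τu ∈ H := Subgroup.subset_closure (Or.inr rfl)
  have hττ : τu * τu = 1 := Units.ext (permMatrix_prodComm_mul_self' k m)
  have hleft : leftMonomialSubst k m ≤ H :=
    (LRPairs.leftMonomialSubst_le_closure k m).trans (Subgroup.closure_mono Set.subset_union_left)
  have hright : rightMonomialSubst k m ≤ H := by
    unfold rightMonomialSubst
    rw [Subgroup.closure_le]
    rintro δ ⟨h, hh, hδ⟩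
    have hδ' : τu * δ * τu ∈ leftMonomialSubst k m := by
      refine Subgroup.subset_closure ⟨h, hh, ?_⟩
      rw [Units.val_mul, Units.val_mul, hδ]
      exact permMatrix_prodComm_mul_kronecker_mul' k m 1 (h : Matrix (Fin m) (Fin m) k)
    have hδeq : δ = τu * (τu * δ * τu) * τu := by
      rw [← mul_assoc, ← mul_assoc, hττ, one_mul, mul_assoc, hττ, mul_one]
    change δ ∈ H
    rw [hδeq]
    exact H.mul_mem (H.mul_mem hτ (hleft hδ')) hτ
  unfold permSymmetrySubst
  rw [Subgroup.closure_le]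
  rintro γ ((hγ | hγ) | hγ)
  · exact hleft hγ
  · exact hright hγ
  · exact Subgroup.subset_closure (Or.inr hγ)

end PermGroup

/-! ### Equivariance and the discharge of `lr_prop_2_10` -/

section PermEquivariance

variable {k : Type*} [Field k] {m : ℕ}

/-- **Prop. 2.10: `Ã` RESPECTS `𝔾_{perm_m}`.** For every field `k`, `m ≥ 1`, `c ≠ 0` and every
indexing `e : FullIdx m ≃ Fin n`, Prop. 2.10's matrix with scalar `c` on `Λ₀`, transported along `e`,
is an affine determinantal representation of `(-1)^{m+1} c^{n-m} m! · perm_m` with exact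
`GL_n × GL_n` lifts of all of `permSymmetrySubst k m` (torus and permutations of `E` through the
monomial bases, the transposition through the swap of the two tensor factors, `F`-symmetries by
conjugation). [cite: LandsbergRessayre2017, Prop. 2.10] -/
theorem isEquivariantDetRepr_permFullMatrix (hm : 1 ≤ m) {c : k} (hc : c ≠ 0) {n : ℕ}
    (e : FullIdx m ≃ Fin n) :
    IsEquivariantDetRepr (permSymmetrySubst k m)
      (C ((-1) ^ (m + 1) * c ^ ((2 * m).choose m - 1 - m) * (m.factorial : k)) * perPoly (Fin m) k)
      (Matrix.reindex e e (permFullMatrix k m c)) := by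
  refine IsEquivariantDetRepr.anti ?_ (permSymmetrySubst_le_closure_left_transpose k m)
  refine IsEquivariantDetRepr.of_generators (isAffineDetRepr_permFullMatrix k hm hc e) ?_
  rintro γ ((⟨π, hγ⟩ | ⟨d, hγ⟩) | hγ)
  · exact exists_lift_leftPerm_perm c e γ π hγ
  · exact exists_lift_leftDiag_perm c e γ d hγ
  · exact exists_lift_transpose_perm c e γ hγ

end PermEquivariance

end LR17

section PermDischarge

/-- **Discharge of the named fact `lr_prop_2_10`** (LR17 Prop. 2.10, p0006:L66–L82): for every
`m ≥ 1` and every bijection `e : LR17.FullIdx m ≃ Fin n`, `LR17.permFullMatrix ℂ m ((m!)^{-1/(n-m)})`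
transported along `e` is an affine determinantal representation of `(-1)^{m+1} perm_m` that RESPECTS
the realised symmetry group `permSymmetrySubst ℂ m = 𝔾_{perm_m}` (exact lifts).
[cite: LandsbergRessayre2017, Prop. 2.10] -/
theorem lr_prop_2_10_holds : lr_prop_2_10 := by
  intro m hm n e
  have h := LR17.isEquivariantDetRepr_permFullMatrix hm (LR17.lamScale_ne_zero m) e
  rw [mul_assoc, LR17.lamScale_pow_mul_factorial hm, mul_one] at h
  exact h

/-- **LR17 Thm. 2.13, UNCONDITIONALLY** (p0006:L127–L129: "`\srdc(det_m) = C(2m,m) - 1`"): for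
`m ≥ 1` the regular `𝔾_{det_m}`-equivariant determinantal complexity of `det_m` is exactly
`C(2m,m) - 1` — the upper half is Prop. 2.17 (`lr_prop_2_17_holds`,
`LR17FullExteriorDetReprProofs.lean`), the lower half `lr_thm_2_13_ge_holds`
(`LR17RegularDetLowerBounds.lean`). [cite: LandsbergRessayre2017, Thm. 2.13] -/
theorem LR17.regularEquivariantDetComplexity_detPoly_eq_choose_sub_one {m : ℕ} (hm : 1 ≤ m) :
    regularEquivariantDetComplexity (detSymmetrySubst ℂ m) (detPoly (Fin m) ℂ) = (2 * m).choose m - 1 :=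
  lr_thm_2_13_eq_of_prop_2_17 lr_prop_2_17_holds hm

end PermDischarge

end Literature.Computability.AlgebraicComplexity

end
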